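import Mathlib
import HarnessLib
import HarnessLib.Audit
import Summits.HodgeConjecture.Statement
import Literature.AlgebraicGeometry.Motives.Sweep1
import Literature.AlgebraicGeometry.Motives.FamiliesVHS
import Literature.AlgebraicGeometry.HodgeTheory.GysinFormalism
import Literature.AlgebraicGeometry.HodgeTheory.HodgeModelExistence
import Literature.AlgebraicGeometry.HodgeTheory.NodalHypersurface
import Literature.AlgebraicGeometry.HodgeTheory.VanishingCycleOfNode
import Literature.AlgebraicGeometry.HodgeTheory.SpecialisationMapComplexPoints
import Summits.HodgeConjecture.HodgeConjecture.Theorems.NodalSupportHodgeModels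
import HarnessLib.Audit.Status.Attr

/-!
Route: IncidenceNodePeeling

DORMANT since 2026-08-24T05:40:44Z (reconciler: no traction for 6.6 d (last activity item-proof-filed at 2026-08-17T15:15:04Z); parked, not closed — `ledger route dormant route-HodgeConjecture-IncidenceNodePeeling --off` to reactivate) — unstaffed, not closed; items shared with open routes are served there. `ledger route dormant <id> --off` reactivates.

Route IncidenceNodePeeling — realises idea card incidence-divisor-node-rigidification
(HodgeConjecture/HodgeConjecture).

THESIS X (it suffices to show): NodalExhaustion for even-dimensional hypersurfaces, plus two
imported regimes.
(X1, this route's content = HCMovablePairs) For X = V(F) ⊂ ℙ^{2p+1}_ℂ smooth of degree d and ζ ∈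
H^{2p}(X,ℚ) of type (p,p) whose Hodge-locus component in |O(d)| is positive-dimensional modulo
PGL_{2p+2} ("movable pair"), ζ is algebraic — proved by NODAL EXHAUSTION: (a) FORCING: over a
general surface S in the normalised closure Z̄' of the Hodge locus, the incidence divisor D ⊂
ℙ^{2p+1} × S has only ambient cohomology (Artin–Lefschetz) while ζ comes from IH^{2p}(D) (invariant
cycles), so D must fail to be a ℚ-homology manifold along a curve: a divisor Δ_Z of Z̄'∩Δ of 1-nodal
members met with even contact order, i.e. ⟨ζ,δ⟩ ≠ 0 for the vanishing cycle δ (case B); (b) PEELING: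
pass to (X₁, ζ₁ = ζ − (⟨ζ,δ⟩/⟨δ,δ⟩)δ) inside the 1-nodal stratum and repeat keeping the nodes;
distinct nodes are orthogonal, so q(ζ_v) = (−1)^p⟨ζ_v,ζ_v⟩ drops by ⟨ζ,δ_i⟩²/2 ≥ 1/2 per step and
the chain stops after ≤ 2q(ζ_v) steps (PeelingBound); (c) END STATE: when no case-B node is left,
either the pair has become rigid or a further forced degeneration X_∞ in the closure of the Hodge
locus carries the limit class as a class SUPPORTED in codimension p (the card's 'ambient end state'
is false already for (quartic, line): Σ⟨ℓ,δ_i⟩² = 9/2 is impossible); (d) RETURN (repaired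
2026-08-15: no small resolutions — for p ≥ 2 the base-changed (2p+1)-fold nodes are factorial; one
BLOWS THEM UP, Thomas2005Nodes §3): on the semistable model X̃_k ∪ ⋃_i Q_i^{2p} the limit class is
the pre-log cycle W̃ + Σ_i V_i (W the supported cycle on the nodal fibre, V_i a ℚ-combination of
ruling p-planes of the exceptional quadric Q_i with A/B-imbalance c_i = ⟨ζ,δ_i⟩/⟨δ_i,δ_i⟩), and it
propagates back, one degeneration step at a time and then along the smooth part of each Hodge-locus
component, because its obstructions are governed by the Hodge condition defining the locus (log
semiregularity); typed as ReturnAlongHodgeLocus = 'return across the nodes of ONE degeneration' on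
real carriers (k = 0: Grothendieck's local variational Hodge statement).
(X2, imported) HCRigidPairs: pairs whose Hodge-locus component is a PGL-orbit closure are algebraic
(BKU-typical in every open (p,d); owned by the arithmetic/anchor lines).
(X3, bookkeeping) Lefschetz reduction of HC for hypersurfaces to the middle degree of
even-dimensional ones, existence of Hodge models, and the complement regime of non-hypersurfaces
(not attacked; no reduction of HC to hypersurfaces is known).

Lean (all constants exist; elaborated in the planner's Sketch.lean, lean check rc 0, 2026-08-15):
Assembly := HCMovablePairs → HCRigidPairs → HypersurfaceMiddleReduction → HCNonHypersurfaces → (∀ n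
X, Literature.AlgebraicGeometry.HodgeTheory.nonempty_hodgeModel n X) → _root_.HodgeConjecture,
where MOVABLE(p,d,X,ζ) := ∃ (S 𝒳 : SchemeOver ℂ) (f : 𝒳 ⟶ S) (s : ComplexPoints S) (e : fiberOver f
s ≅ X) (Ξ : complexBetti 𝒳 (2p)), IsSmoothProjectiveFamily f (2p) ∧ LocallyOfFiniteType S.hom ∧
IrreducibleSpace S ∧ (∀ t, IsSmoothHypersurface (2p) d (fiberOver f t)) ∧ (∃ t, IsEmpty (fiberOver f
t ≅ fiberOver f s)) ∧ IsRationalClass Ξ ∧ (∀ t, IsOfHodgeType (2p) (fiberOver f t) (2p) p p (Ξ|_t))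
∧ Ξ|_s = e^*ζ  (theorem of the fixed part + CDK: ⇔ positive-dimensional Hodge locus mod PGL),
HCMovablePairs := ∀ p d X ζ, IsSmoothHypersurface (2p) d X → IsRationalClass ζ → IsOfHodgeType (2p)
X (2p) p p ζ → MOVABLE → ζ ∈ algebraicClasses X p, and HCRigidPairs the same with ¬MOVABLE. The
assembly is pure logic; the mathematics is in the cruxes ForcingCaseB ≻ EndStateSupported (informal:
need IH / discriminant / Hodge-locus-component definitions) ≻ ReturnAlongHodgeLocus (TYPED
2026-08-15 over IsNode, IsSpecialisingNhd/specialisationMap, vanishingHomology, cupPairing,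
algebraicClasses of the nodal fibre; lean check rc 0) — the intended glued children of
HCMovablePairs.

Rationale: WHY THIS LINE. For hypersurfaces the whole content of HC sits on Hodge loci (Noether–Lefschetz: the
general member has no primitive Hodge class). The card imports singularity theory and the topology
of the decomposition theorem (Milnor fibrations, intersection cohomology, Picard–Lefschetz for
EVEN-dimensional nodes: pure limits, reflections, ℚ-homology-manifold nodal fibres) into the
Hodge-locus picture of CattaniDeligneKaplan1995 / Voisin2007HodgeLoci: it degenerates X ITSELF
inside its own Hodge locus and reads the class off the failure of Poincaré duality of ONE incidence
divisor (nearest prior art degenerates hyperplane SECTIONS of X: Thomas2005Nodes Thm 1,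
GreenGriffiths2007Singularities, BrosnanFangNiePearlstein2009, DecataldoMigliorini2009). Numbers
that shape the route (planner, this session): the (p,d) for which ALL pairs are movable for
dimension reasons, h^{p-1,p+1} = dim R_F^{pd-2p-2} < dim|O(d)| − dim PGL, are exactly
{(2,3),(2,4),(2,5),(3,3),(4,3)} — precisely the classically solved cases (Zucker1977CubicFourfolds;
ConteMurre1978; Paranjape1994SmallChow Prop 4.1.4 ⇒ cubic sixfolds via CH₀=CH₁=ℤ + Lefschetz(1,1);
Terasoma1990); in every OPEN case the expected dimension of Hodge loci mod PGL is ≤ 0, so this route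
owns the ATYPICAL positive-dimensional components (they exist: AljovinMovasatiVillaflor2019,
DuquefrancoVillaflorloyola2023, Kloosterman2025) and reduces HC for even hypersurfaces to the rigid
regime (HCRigidPairs, imported). Planner correction to the card: with kept (orthogonal) nodes
termination is free (PeelingBound, ≤ 2q(ζ_v) steps) but the card's end state 'residual class
ambient' is impossible already for (quartic surface, line): it needs Σ⟨ℓ,δ_i⟩² = 9/2; hence crux
EndStateSupported.
RANKED CRUXES. 2 ForcingCaseB (informal): forcing ⇒ a divisor of 1-nodal members with ⟨ζ,δ⟩ ≠ 0
(even contact order ⇔ non-ℚHM transversal type of D, Milnor Thm 8.5 + Thom–Sebastiani); may fail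
through vertical non-isolated singular loci or non-A₁ transversal types. 3 EndStateSupported
(informal): at the end of the chain the limit class is supported in codim p on a further forced
degeneration, or the pair is rigid; may fail by a coniveau defect (class carried by the singular
locus but not a cycle class: Grothendieck1969 phenomena). 4 ReturnAlongHodgeLocus (TYPED, repaired
after crux-attacks gen-1/2 — blow-up/quadric-ruling picture, no small resolutions): across ONE
degeneration inside the Hodge locus (proper flat family, special fibre with k even-dimensional ODPs,
vanishing cycles δ_i orthogonal and non-isotropic, ζ Hodge over the punctured neighbourhood),
'residual ζ − Σc_iδ_i = sp(α) with α supported in codim p on the nodal fibre' ⇒ 'ζ algebraic on the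
nearby smooth fibre' (k = 0: local VHC; Bloch1972Semiregularity, BuchweitzFlenner2003,
BlochEsnaultKerz2014CharZero, arXiv:2009.01651); may fail for p ≥ 2 (no log-semiregularity theorem
for pre-log cycles W̃ + ΣV_i on X̃₀ ∪ Q_i; non-reduced Hodge loci). 5 HCMovablePairs (typed): their
conjunction. 6 HCRigidPairs (typed, imported). Supports: IncidenceForcing (the Lefschetz–IH–Milnor
theorem, paper-provable now, stand-alone deliverable), PeelingBound (Mathlib-provable now),
HypersurfaceMiddleReduction (Lefschetz), HCNonHypersurfaces (complement), Assembly (pure logic,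
checked provable in Sketch.lean).
KILL CRITERIA. (i) A movable pair (in any open (p,d)) for which every component of Z̄'∩Δ through
nodal members is transverse (⟨ζ,δ⟩ = 0) AND no non-ℚHM degeneration occurs in codimension 1 refutes
ForcingCaseB's engine (check first: cubic fourfolds ⊃ plane, C̄₈ ∩ C₆ in Hassett's notation; quartic
surfaces ⊃ line — verified case B with ⟨ℓ,δ⟩ = ±1). (ii) An end state whose IH-defect class is
provably not supported in codim p closes the route as a reduction-to-nothing. (iii) Refutation of
HCMovablePairs = counterexample to HC. Refutation of HCRigidPairs kills HC, not this line.
NOT DECOMPOSED YET. The typed split of HCMovablePairs into its three children (IsNodalHypersurface,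
VanishingCycleOfNode, SpecialisationMapComplexPoints LANDED 2026-08-15 and carry the typed
ReturnAlongHodgeLocus; still wanted for ForcingCaseB / EndStateSupported / IncidenceForcing:
intersection cohomology and perverse sheaves on complex points, Milnor fibres and the
ℚ-homology-manifold criterion, the discriminant of |O(d)|, Hodge-locus components as algebraic
varieties (CDK)); the interface EndStateSupported → ReturnAlongHodgeLocus: (i) the cycle-level
pre-log matching along Q_i^{2p−1} (refuter D6: the δ_i-coefficient is the A/B-imbalance of the
tangent-cone filling of W at the node) is built inside the return step from [W] = α, CH = H on
quadrics; (ii) the return from a NON-nodal end X_∞ (EndStateSupported exit (b)) needs a semistable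
model and a log version of ReturnAlongHodgeLocus, or EndStateSupported sharpened to output α on the
nodal X_k itself — the typed item is the special case 'end = X_k'; (iii) REVIEW2 objection G1: the
branch 'chain ends rigid at a NODAL pair' needs an HCRigidPairs-type input for nodal pairs
(unfiled); the extension of scope from hypersurfaces to even-dimensional complete intersections /
ample divisors X ⊂ P with H^{2p}(P)|_X algebraic (same engine); the precise transversal-type table
(which (T,m) carry classes) beyond A₁; integral refinements (coefficients c_i ∈ ½ℤ).
CHEAPEST FALSIFIER. For the line: the lattice computation of kill criterion (i) on cubic fourfolds ⊃
plane (is some component of C̄₈ ∩ C₆ a tangency component with ⟨ζ,δ⟩ ≠ 0?) and on quartic surfaces ⊃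
line (done: case B, ⟨ℓ,δ⟩ = ±1). For the repaired ReturnAlongHodgeLocus: its p = 1 instances must be
consistent with Lefschetz (1,1) (quartic ⊃ line, node on the line: c = ±1/2, residual q ∈
{7/4,5/4,3/4}), its k = 1 cubic-fourfold instance (plane Π, node on Π, flat limit Π̃ + V on X̃₀ ∪
Q⁴, c = ±1/2, Gram det 13 — refuter gen-2) with Hassett's lattice; any instance where sp(α), α
algebraic on the nodal fibre, stays Hodge nearby yet is provably non-algebraic would refute HC
itself.
SOURCES: Thomas2005Nodes; KollarMori1998 (L.2.62/Cor.2.63, held p.60); Hartshorne1977 (II Ex.6.5,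
held p.188); Steenbrink1976; Clemens1977; BlochEsnaultKerz2014CharZero; arXiv:2104.14845;
CattaniDeligneKaplan1995; Voisin2007HodgeLoci; VoisinHodgeII2003 §5.3; DecataldoMigliorini2009;
BrosnanFangNiePearlstein2009; GreenGriffiths2007Singularities; KerrPearlstein2011; Milnor1968;
Schoen1985; Bloch1972Semiregularity; BuchweitzFlenner2003; Paranjape1994SmallChow; Terasoma1990
(WANTED acq-01766, cite-only); Zucker1977CubicFourfolds; ConteMurre1978; BaldiKlinglerUllmo2024;
KlinglerOtwinowskaUrbanik2023; DuquefrancoVillaflorloyola2023; Kloosterman2025; arXiv:2009.01651.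

Novelty: NEAREST PRIOR ART (searched this session + the card's two refuter audits): (i) Thomas2005Nodes =
arXiv:math/0212216 READ pp.3-6: HC ⇔ existence of nodal hypersurface SECTIONS D ⊂ X^{2n} carrying
PD[A] (Thm 1), PL/Schoen exact sequence for desingularised nodal hypersurfaces (Schoen1985 Lemma
1.1) — the degeneration calculus, applied to sections of a FIXED X; (ii) DecataldoMigliorini2009,
BrosnanFangNiePearlstein2009, GreenGriffiths2007Singularities, KerrPearlstein2011: a primitive Hodge
class is detected by singularities of normal functions / the discriminant-supported (non-IC) summand
for the universal family of hyperplane sections — the published 'H vs IH defect over Δ' idea; (iii)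
Griffiths–Harris IVHS II (Compositio 50, 1983), CattaniDeligneKaplan1995, Voisin2007HodgeLoci,
VoisinHodgeII2003 §5.3, Movasati (doi:10.4310/ajm.2017.v21.n3.a3, doi:10.1007/s12215-020-00523-4),
AljovinMovasatiVillaflor2019, DuquefrancoVillaflorloyola2023, Kloosterman2025: structure/dimension
of Hodge loci of even-dimensional hypersurfaces at SMOOTH points; none studies their contact with
the discriminant. Searches run now: lit search --hybrid 'Hodge conjecture cubic hypersurfaces
eightfolds sixfolds' (found Terasoma1990, Paranjape1994SmallChow ⇒ movable-generic range entirely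
classical); zbmath 'Hodge conjecture cubic hypersurfaces' (Terasoma 1990, Kloosterman 2025, Movasati
2022 withdrawn 'On a Hodge locus'), 'Noether-Lefschetz locus singular' (Kim 1991,
Ciliberto–Harris–Miranda 1988, Movasati 20  [refs: 10.4310/ajm.2017.v21.n3.a3, 10.1007/s12215-020-00523-4, math/0212216, doi:10.4310/ajm.2017.v21.n3.a3, doi:10.1007/s12215-020-00523-4, Schoen1985, DecataldoMigliorini2009, BrosnanFangNiePearlstein2009, KerrPearlstein2011, CattaniDeligneKaplan1995, VoisinHodgeII2003, AljovinMovasatiVillaflor2019, DuquefrancoVillaflorloyola2023, Kloosterman2025, Terasoma1990, BuchweitzFlenner2003]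

Barriers (technique_class: lefschetz-incidence, vanishing-cycles, nodal-degeneration): Literature.Barriers.HodgeConjecture.Voisin2003_generalHypersurface_noIntegralClassInF: evaded — no
Lefschetz pencil of sections, no intermediate Jacobian, no Jacobi inversion; the induction runs
through nodal degenerations of X itself inside its Hodge locus and the cycles are PRE-LOG cycles —
supported limit classes on the nodal fibre plus ℚ-combinations of ruling p-planes of the exceptional
quadrics of the BLOWN-UP base-changed total-space nodes (factorial for p ≥ 2: no small resolution;
corrected 2026-08-15) — with ℚ-coefficients throughout (the barrier's integral statement is not
touched).
Literature.Barriers.HodgeConjecture.CattaniDeligneKaplan1995_hodgeLocus_algebraicFor: used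
POSITIVELY and essentially (algebraicity + finiteness of Z̄' → Z̄ make S, D algebraic and
single-valuedness of ζ over Z̄'); nothing is claimed about fields of definition.
Literature.Barriers.HodgeConjecture.Grothendieck1969_generalHodgeConjecture_false: APPLIES to crux
EndStateSupported as the honest risk — the end-state class might be carried by the singular locus
with the wrong coniveau; the route asserts support in codimension exactly p only for level-0 (Hodge)
classes and makes no GHC claim; this is why EndStateSupported is a crux and not support.
Literature.Barriers.HodgeConjecture.BlochSrinivas1983_hodgeTypeL0_vanish_of_chowZeroSupported: not
used as a tool (no decomposition of the diagonal); it only explains why the movable-generic cases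
(cubic six- /eightfolds) are already known (Paranjape19

Novelty grade: new-combination — ROUTE REVIEW #2 refuter c8da4637 (evidence REVIEW2-IncidenceNodePeeling.md on route + 2488). NOVELTY new-combination: (i) the H-vs-IH defect over the discriminant / singularities-of-normal-functions idea (BFNP2009, deCataldo–Migliorini2009, Green–Griffiths2007, Kerr–Pearlstein2011) and Thomas2005's  (refuter refuter-rreview-route-HodgeConjecture-In-c8da4637-0, 2026-08-15T12:37:26Z; prior: Thomas2005Nodes (math/0212216), BrosnanFangNiePearlstein2009, DecataldoMigliorini2009, GreenGriffiths2007Singularities, KerrPearlstein2011, CattaniDeligneKaplan1995, Voisin2007HodgeLoci, Schoen1985)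

History (route lifecycle, newest last):
- 2026-08-15T21:31:28Z · rev 4: restated ReturnAlongHodgeLocus (stmt-HodgeConjecture-2512) — repair (route-repair, refuted-misstated): ReturnAlongHodgeLocus (stmt-HodgeConjecture-2512) restated after crux-attacks gen-1/gen-2 — the gloss 'exceptional P^p (planner-rrefute-HodgeConjecture-IncidenceNodeP-7c9c461b-0)
- 2026-08-24T05:40:44Z · DORMANT — reconciler: no traction for 6.6 d (last activity item-proof-filed at 2026-08-17T15:15:04Z); parked, not closed — `ledger route dormant route-HodgeConjecture-Inc (operator:999:3413353)

sub-problem: HodgeConjecture · status: dormant · opened planner-plancard-HodgeConjecture-HodgeConject-0ccb34c1-0 2026-08-15T11:03:16Z · rev 5 · ledger route-HodgeConjecture-IncidenceNodePeeling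
GENERATED by the gate from the ledger (D-0016/17). Provers cite these decls: `theorem foo : Summit.HodgeConjecture.HodgeConjecture.Theses.IncidenceNodePeeling.<Decl> := …` in Summits/HodgeConjecture/HodgeConjecture/Theorems/<Name>.lean.
-/

namespace Summit.HodgeConjecture.HodgeConjecture.Theses.IncidenceNodePeeling

open scoped BigOperators Topology Manifold Classical MeasureTheory ProbabilityTheory Matrix InnerProductSpace ComplexConjugate ContinuousMap
open Filter Set Function TopologicalSpace MeasureTheory

attribute [summit_statement] _root_.HodgeConjecture

-- item stmt-HodgeConjecture-2474 · crux · rank 2 · open · by planner — informal only, no Lean statement yet: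
--   [crux] FORCING ⇒ CASE B (informal until IsNodalHypersurface / vanishing cycles / IH are defined;
--   definition requests filed). SETTING: X = V(F) ⊂ ℙ^{2p+1}_ℂ smooth of degree d, ζ ∈ H^{2p}(X,ℚ) of
--   type (p,p) with vanishing part ζ_v ≠ 0, (X,ζ) MOVABLE (hypothesis of HCMovablePairs: Hodge-locus
--   component Z ⊂ |O(d)| positive-dimensional mod PGL); Z̄' = normalised closure of Z (finite over Z̄,
--   CattaniDeligneKaplan1995 Thm 1.1; ζ single-valued over Z̄'°), Δ = discriminant. CLAIM: there is an
--   irreducible DIVISOR Δ_Z of Z̄' ∩ Δ whose general member X₁ has exactly one ordinary double point,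
--   with vanishi

-- item stmt-HodgeConjecture-2488 · crux · rank 3 · open · by planner — informal only, no Lean statement yet:
--   [crux] END STATE OF THE NODAL CHAIN. Iterate ForcingCaseB inside the closure of the Hodge locus
--   KEEPING the nodes: at stage j the family is {j-nodal degree-d hypersurfaces along which ζ_j := ζ −
--   Σ_{i≤j} (⟨ζ,δ_i⟩/⟨δ_i,δ_i⟩) δ_i stays Hodge} (even-dimensional nodes are ℚ-homology-manifold points
--   — A₁ in 2p+1 variables has ⟨δ,δ⟩ = ±2 ≠ 0 — so H^{2p}(X_j,ℚ) = ∩_{i≤j} δ_i^⊥ ⊂ H^{2p}_lim is PURE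
--   and the forcing engine applies verbatim with Sing(D) replaced by the non-ℚHM locus of D). Distinct
--   nodes of one fibre have orthogonal vanishing cycles, so for ζ integral each step lowers q(ζ_v) =
--   (−1)^p⟨ζ_v,

-- earlier ReturnAlongHodgeLocus (stmt-HodgeConjecture-2512, replaced 2026-08-15T21:31:28Z -> stmt-HodgeConjecture-13854): retired by None — [crux] RETURN ALONG THE HODGE LOCUS (the variational step). If X_∞ is a member of the closure Z̄ of the Hodge-locus component of the movable pair (X,ζ), reached through the case-B nodal chain of ForcingCaseB/EndStateSupported, and the limit class ζ_lim lies in N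
/-- item stmt-HodgeConjecture-13854 · crux · rank 4 · open · by planner
why it might fail: k=0 is already Grothendieck's local VHC (open; BEK 2014 give only the formal lift); for p≥2 no semiregularity/T¹-lifting theorem covers pre-log cycles W̃+ΣV_i on the snc fibre X̃₀∪Q_i (Bloch: lci; BF2003: perfect cxs; Kloosterman: c.i.); Hodge loci can be non-reduced (Dan; DFV2023 Fermat).
sources: Thomas2005Nodes, Schoen1985, Bloch1972Semiregularity, BuchweitzFlenner2003, BlochEsnaultKerz2014CharZero, arXiv:2009.01651
[crux] RETURN ACROSS THE NODES, ALONG THE HODGE LOCUS (repaired 2026-08-15, crux-attacks gen-1/2,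
refuted-misstated gloss: 'exceptional ℙ^p of the SMALL RESOLUTIONS of the base-changed (2p+1)-fold
nodes' do not exist — for p ≥ 2 the node Σ_{i≤2p+1}y_i² = s² is factorial (Hartshorne1977 II
Ex.6.5(b)(3), held p.188; SGA2 XI 3.14) hence has no small resolution (KollarMori1998
L.2.62/Cor.2.63, held p.60); Thomas2005Nodes §3 (read p.5) BLOWS the nodes UP and uses the ruling
classes A_i − B_i of the exceptional quadrics). TYPED on real carriers as the collapsed inductive
form = ONE degeneration step (k ≥ 0 new nodes; k = 0 = propagation along the smooth part of a
Hodge-locus component): f : 𝒳 → S proper flat; U ∋ t₀ a specialising neighbourhood (H^{2p}(f⁻¹U) ≅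
H^{2p}(X_{t₀})); fibres over U∖{t₀} smooth projective of dimension 2p; the special fibre X_{t₀} has
exactly k singular points, all nodes (IsNode ℂ (2p): even-dimensional ODPs, so X_{t₀} is a
ℚ-homology manifold and algebraicClasses X_{t₀} p = N^pH^{2p} is spanned by classes of codim-p
subvarieties); t ∈ U∖{t₀}; δ_1..δ_k ∈ H^{2p}(X_t) rational, pairwise orthogonal, non-isotropic
(⟨δ_i,δ_i⟩ = ±2), with Poincaré duals spanning the van -/
@[route_item "route-HodgeConjecture-IncidenceNodePeeling"]
def ReturnAlongHodgeLocus : Prop :=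
  ∀ (p k : ℕ) (𝒳 S : Literature.AlgebraicGeometry.Motives.SchemeOver ℂ) (f : 𝒳 ⟶ S) (t₀ t : Literature.AlgebraicGeometry.Motives.ComplexPoints S) (U : _root_.Set (Literature.AlgebraicGeometry.Motives.ComplexPoints S)) (hU : Literature.AlgebraicGeometry.HodgeTheory.IsSpecialisingNhd f t₀ (2 * p) U) (ht : t ∈ U) (ht' : t ∈ U \ {t₀}), AlgebraicGeometry.IsProper f.left → AlgebraicGeometry.Flat f.left → (∃ N : Finset ↥(Literature.AlgebraicGeometry.Motives.fiberOver f t₀).left, N.card = k ∧ (∀ x : ↥(Literature.AlgebraicGeometry.Motives.fiberOver f t₀).left, x ∈ N ↔ ¬ IsRegularLocalRing ((Literature.AlgebraicGeometry.Motives.fiberOver f t₀).left.presheaf.stalk x)) ∧ ∀ x ∈ N, IsClosed ({x} : _root_.Set ↥(Literature.AlgebraicGeometry.Motives.fiberOver f t₀).left) ∧ Literature.AlgebraicGeometry.HodgeTheory.IsNode ℂ (2 * p) x) → (∀ s ∈ U \ {t₀}, Literature.AlgebraicGeometry.Motives.IsSmoothProjective (2 * p) (Literature.AlgebraicGeometry.Motives.fiberOver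 f s)) → ∀ (μ : Literature.AlgebraicTopology.SingularHomology.HomologicalOrientation ℂ (Literature.AlgebraicGeometry.Motives.ComplexPoints (Literature.AlgebraicGeometry.Motives.fiberOver f t)) (2 * (2 * p))) (δ : Fin k → Literature.AlgebraicGeometry.HodgeTheory.complexBetti (Literature.AlgebraicGeometry.Motives.fiberOver f t) (2 * p)), (∀ i, Literature.AlgebraicGeometry.HodgeTheory.IsRationalClass (δ i)) → Submodule.span ℂ (_root_.Set.range fun i => Literature.AlgebraicTopology.SingularHomology.poincareDualityMap μ (two_mul (2 * p)).symm (δ i)) = Literature.AlgebraicGeometry.HodgeTheory.vanishingHomology ℂ f ht (2 * p) → (∀ i j, i ≠ j → Literature.AlgebraicTopology.SingularHomology.cupPairing μ (two_mul (2 * p)).symm (δ i) (δ j) = 0) → (∀ i, Literature.AlgebraicTopology.SingularHomology.cupPairing μ (two_mul (2 * p)).symm (δ i) (δ i) ≠ 0) → ∀ ζ : Literature.AlgebraicGeometry.HodgeTheory.complexBetti (Literature.AlgebraicGeometry.Motives.fiberOver f t) (2 * p), Literature.AlgebraicGeometry.HodgeTheory.IsRationalClass ζ → Literature.AlgebraicGeometry.HodgeTheory.IsOfHodgeType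 (2 * p) (Literature.AlgebraicGeometry.Motives.fiberOver f t) (2 * p) p p ζ → (∃ Ξ : Literature.AlgebraicTopology.SingularHomology.singularCohomology ℂ ℂ ↥(Literature.AlgebraicGeometry.HodgeTheory.tubeOver f (U \ {t₀})) (2 * p), Literature.AlgebraicGeometry.HodgeTheory.fiberRestrict f ht' (2 * p) Ξ = ζ ∧ ∀ (s : Literature.AlgebraicGeometry.Motives.ComplexPoints S) (hs : s ∈ U \ {t₀}), Literature.AlgebraicGeometry.HodgeTheory.IsRationalClass (Literature.AlgebraicGeometry.HodgeTheory.fiberRestrict f hs (2 * p) Ξ) ∧ Literature.AlgebraicGeometry.HodgeTheory.IsOfHodgeType (2 * p) (Literature.AlgebraicGeometry.Motives.fiberOver f s) (2 * p) p p (Literature.AlgebraicGeometry.HodgeTheory.fiberRestrict f hs (2 * p) Ξ)) → (∃ α ∈ Literature.AlgebraicGeometry.HodgeTheory.algebraicClasses (Literature.AlgebraicGeometry.Motives.fiberOver f t₀) p, Literature.AlgebraicGeometry.HodgeTheory.specialisationMap hU ht α = ζ - ∑ i : Fin k, (Literature.AlgebraicTopology.SingularHomology.cupPairing μ (two_mul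 (2 * p)).symm ζ (δ i) / Literature.AlgebraicTopology.SingularHomology.cupPairing μ (two_mul (2 * p)).symm (δ i) (δ i)) • δ i) → ζ ∈ Literature.AlgebraicGeometry.HodgeTheory.algebraicClasses (Literature.AlgebraicGeometry.Motives.fiberOver f t) p

/-- item stmt-HodgeConjecture-2348 · crux · rank 5 · open · by planner
why it might fail: = HC for pairs with Hodge-locus component positive-dimensional mod PGL: open in every (p,d) beyond p=1 and {(2,3),(2,4),(2,5),(3,3),(4,3)}; only minimal-codimension components are classified (Otwinowska 2003, Villaflor 2022, DFV 2023: linear ℙ^p). A non-algebraic movable class = HC counterexample.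
sources: Voisin2007HodgeLoci, CattaniDeligneKaplan1995, doi:10.1090/s1056-3911-02-00349-1, doi:10.1142/s021919972150053x, DuquefrancoVillaflorloyola2023, Kloosterman2025
[crux] MOVABLE PAIRS ARE ALGEBRAIC — the formal shadow of NodalExhaustion = ForcingCaseB ∧
EndStateSupported ∧ ReturnAlongHodgeLocus (its intended glued children once IsNodalHypersurface /
vanishing-cycle / intersection-cohomology definitions land). (X, ζ): X a smooth hypersurface of even
dimension 2p and degree d in ℙ^{2p+1}_ℂ, ζ rational of type (p,p). MOVABLE := there is a smooth
projective family f : 𝒳 → S of smooth degree-d 2p-dimensional hypersurfaces over an irreducible base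
locally of finite type, non-isotrivial (some fibre not ≅ the marked fibre 𝒳_s ≅ X), and a rational
class Ξ on 𝒳(ℂ) restricting to ζ on 𝒳_s and to a (p,p)-class on every fibre — equivalently (theorem
of the fixed part + CattaniDeligneKaplan1995) the Hodge-locus component of ζ in |O(d)| is
positive-dimensional modulo PGL_{2p+2}. Conclusion: ζ ∈ algebraicClasses X p. Known: p = 1
(Lefschetz (1,1)); (p,d) ∈ {(2,3),(2,4),(2,5),(3,3),(4,3)}, where ALL pairs are movable for
dimension reasons (h^{p-1,p+1} = dim R_F^{pd-2p-2} < dim|O(d)| − dim PGL) and HC is classical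
(Zucker1977CubicFourfolds, ConteMurre1978, Paranjape1994SmallChow Prop 4.1.4 ⇒ cubic sixfolds via
CH_0 = CH_1 = ℤ + Lefschetz (1,1), Terasoma1990). -/
@[route_item "route-HodgeConjecture-IncidenceNodePeeling", crux]
def HCMovablePairs : Prop :=
  ∀ (p d : ℕ) (X : Literature.AlgebraicGeometry.Motives.SchemeOver ℂ) (ζ : Literature.AlgebraicGeometry.HodgeTheory.complexBetti X (2 * p)), Literature.AlgebraicGeometry.Motives.IsSmoothHypersurface (2 * p) d X → Literature.AlgebraicGeometry.HodgeTheory.IsRationalClass ζ → Literature.AlgebraicGeometry.HodgeTheory.IsOfHodgeType (2 * p) X (2 * p) p p ζ → (∃ (S 𝒳 : Literature.AlgebraicGeometry.Motives.SchemeOver ℂ) (f : 𝒳 ⟶ S) (s : Literature.AlgebraicGeometry.Motives.ComplexPoints S) (e : Literature.AlgebraicGeometry.Motives.fiberOver f s ≅ X) (Ξ : Literature.AlgebraicGeometry.HodgeTheory.complexBetti 𝒳 (2 * p)), Literature.AlgebraicGeometry.Motives.IsSmoothProjectiveFamily f (2 * p) ∧ AlgebraicGeometry.LocallyOfFiniteType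 S.hom ∧ IrreducibleSpace S.left ∧ (∀ t : Literature.AlgebraicGeometry.Motives.ComplexPoints S, Literature.AlgebraicGeometry.Motives.IsSmoothHypersurface (2 * p) d (Literature.AlgebraicGeometry.Motives.fiberOver f t)) ∧ (∃ t : Literature.AlgebraicGeometry.Motives.ComplexPoints S, IsEmpty (Literature.AlgebraicGeometry.Motives.fiberOver f t ≅ Literature.AlgebraicGeometry.Motives.fiberOver f s)) ∧ Literature.AlgebraicGeometry.HodgeTheory.IsRationalClass Ξ ∧ (∀ t : Literature.AlgebraicGeometry.Motives.ComplexPoints S, Literature.AlgebraicGeometry.HodgeTheory.IsOfHodgeType (2 * p) (Literature.AlgebraicGeometry.Motives.fiberOver f t) (2 * p) p p ((Literature.AlgebraicGeometry.HodgeTheory.complexBetti.map (Literature.AlgebraicGeometry.Motives.fiberι f t) (2 * p)).hom Ξ)) ∧ (Literature.AlgebraicGeometry.HodgeTheory.complexBetti.map (Literature.AlgebraicGeometry.Motives.fiberι f s) (2 * p)).hom Ξ = (Literature.AlgebraicGeometry.HodgeTheory.complexBetti.map e.hom (2 * p)).hom ζ) → ζ ∈ Literature.AlgebraicGeometry.HodgeTheory.algebraicClasses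 X p

/-- item stmt-HodgeConjecture-2349 · crux · rank 6 · open · by planner
why it might fail: = HC for pairs whose Hodge locus is a finite union of PGL-orbit closures: the BKU-typical case in every open (p,d), and where a hypersurface counterexample to HC would sit (e.g. unverified Hodge classes on Fermat X^{2p}_m, m composite >21, outside hodgeClasses_algebraic_fermat). Not attacked here.
sources: Voisin2007HodgeLoci, BaldiKlinglerUllmo2024, KlinglerOtwinowskaUrbanik2023, Shioda1979HodgeFermat, Literature.AlgebraicGeometry.HodgeTheory.hodgeClasses_algebraic_fermat, arXiv:2312.09268
[crux] RIGID PAIRS ARE ALGEBRAIC — imported co-crux, NOT attacked by this route (owned by the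
arithmetic/anchor lines: cards two-attractor-transcendence-test, qbar-anchors-kou-andre-motivated,
bku-finite-tree-of-flavours, g-function-northcott-isolated-hodge-points). Same (X, ζ) with ¬MOVABLE:
the Hodge-locus component of ζ is a finite union of PGL-orbit closures — the BKU-typical situation
in every open (p,d) (expected dimension ≤ 0), where the pair is defined over a countable field and
absolute-Hodge / field-of-definition methods are the natural tools (Voisin2007HodgeLoci,
BaldiKlinglerUllmo2024, KlinglerOtwinowskaUrbanik2023). Includes the trivial cases d ≤ 2 (all pairs
rigid, HC known: rulings of quadrics) and p = 1 (Lefschetz (1,1)). A refutation kills HC itself, not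
this line; a proof elsewhere plus HCMovablePairs gives HC for all even-dimensional hypersurfaces. -/
@[route_item "route-HodgeConjecture-IncidenceNodePeeling", crux]
def HCRigidPairs : Prop :=
  ∀ (p d : ℕ) (X : Literature.AlgebraicGeometry.Motives.SchemeOver ℂ) (ζ : Literature.AlgebraicGeometry.HodgeTheory.complexBetti X (2 * p)), Literature.AlgebraicGeometry.Motives.IsSmoothHypersurface (2 * p) d X → Literature.AlgebraicGeometry.HodgeTheory.IsRationalClass ζ → Literature.AlgebraicGeometry.HodgeTheory.IsOfHodgeType (2 * p) X (2 * p) p p ζ → ¬ (∃ (S 𝒳 : Literature.AlgebraicGeometry.Motives.SchemeOver ℂ) (f : 𝒳 ⟶ S) (s : Literature.AlgebraicGeometry.Motives.ComplexPoints S) (e : Literature.AlgebraicGeometry.Motives.fiberOver f s ≅ X) (Ξ : Literature.AlgebraicGeometry.HodgeTheory.complexBetti 𝒳 (2 * p)), Literature.AlgebraicGeometry.Motives.IsSmoothProjectiveFamily f (2 * p) ∧ AlgebraicGeometry.LocallyOfFiniteType S.hom ∧ IrreducibleSpace S.left ∧ (∀ t : Literature.AlgebraicGeometry.Motives.ComplexPoints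 S, Literature.AlgebraicGeometry.Motives.IsSmoothHypersurface (2 * p) d (Literature.AlgebraicGeometry.Motives.fiberOver f t)) ∧ (∃ t : Literature.AlgebraicGeometry.Motives.ComplexPoints S, IsEmpty (Literature.AlgebraicGeometry.Motives.fiberOver f t ≅ Literature.AlgebraicGeometry.Motives.fiberOver f s)) ∧ Literature.AlgebraicGeometry.HodgeTheory.IsRationalClass Ξ ∧ (∀ t : Literature.AlgebraicGeometry.Motives.ComplexPoints S, Literature.AlgebraicGeometry.HodgeTheory.IsOfHodgeType (2 * p) (Literature.AlgebraicGeometry.Motives.fiberOver f t) (2 * p) p p ((Literature.AlgebraicGeometry.HodgeTheory.complexBetti.map (Literature.AlgebraicGeometry.Motives.fiberι f t) (2 * p)).hom Ξ)) ∧ (Literature.AlgebraicGeometry.HodgeTheory.complexBetti.map (Literature.AlgebraicGeometry.Motives.fiberι f s) (2 * p)).hom Ξ = (Literature.AlgebraicGeometry.HodgeTheory.complexBetti.map e.hom (2 * p)).hom ζ) → ζ ∈ Literature.AlgebraicGeometry.HodgeTheory.algebraicClasses X p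

/-- item stmt-HodgeConjecture-1943 · support · rank 9 · closed · proved by Summit.HodgeConjecture.HodgeConjecture.Theorems.nodalSupport_hodgeModels_proof @ 6468568b8792 (prover) · by planner
[support] needs-fact: Literature.AlgebraicGeometry.HodgeTheory.nonempty_hodgeModel (route-repair,
cone guardrail 2026-08-15). GENUINELY needed: `Nonempty (HodgeModel n X)` is conjunct 1 of
HodgeTheory.HodgeConjectureFor, i.e. part of the summit statement itself, so every route to
HodgeConjecture must produce it. This decl is VERBATIM the first antecedent of this route's Assembly
(and of NodalSupport's and QbarEnvelope's — re-ask this exact signature there to share the item); it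
is filed as an item so that the closing chain is items-only (`Assembly_holds HodgeModels_holds
IsoInvariance_holds VariationalHodge_holds AnchorExistence_holds : HodgeConjecture` typechecks with
no unfolding; planner Sketch.lean rc 0, where `HodgeModels ↔ ∀ n X, IsSmoothProjective n X →
Nonempty (HodgeModel n X)` is Iff.rfl) and so that the fact is named in the ledger as tier-0 debt of
the summit. HOW IT CLOSES: one line, `fun n X => nonempty_hodgeModel_holds`, once the Literature
fact is discharged — the reduction is already in tree:
HodgeModelExistenceDischarge.nonempty_hodgeModel_of_deRham_of_hodgeDecomposition (remaining leaves:
the real de Rham theorem exists_deRhamIsoFamily and the Hodge decomposition -/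
@[route_item "route-HodgeConjecture-IncidenceNodePeeling", crux]
def HodgeModels : Prop :=
  ∀ (n : ℕ) (X : Literature.AlgebraicGeometry.Motives.SchemeOver ℂ), Literature.AlgebraicGeometry.HodgeTheory.nonempty_hodgeModel n X

/-- `HodgeModels` holds: proved by `Summit.HodgeConjecture.HodgeConjecture.Theorems.nodalSupport_hodgeModels_proof` @ 6468568b8792. -/
theorem HodgeModels_holds : HodgeModels := _root_.Summit.HodgeConjecture.HodgeConjecture.Theorems.nodalSupport_hodgeModels_proof

/-- item stmt-HodgeConjecture-2350 · support · rank 9 · closed · proved by Summit.HodgeConjecture.HodgeConjecture.Theorems.incidenceNodePeeling_hypersurfaceMiddleReduction_proof @ 61a61a751adc (prover) · by planner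
sources: VoisinHodgeII2003, Thomas2005Nodes
[support] LEFSCHETZ REDUCTION: HC for every smooth hypersurface X^n_d ⊂ ℙ^{n+1}_ℂ (all codimensions,
odd n included) follows from the middle-degree statement for even n together with the existence of
Hodge models (hypothesis `nonempty_hodgeModel`, a named fact: Serre GAGA + de Rham + Hodge): for 2k
< n, H^{2k}(X) = ℚh^k by weak Lefschetz, for 2k > n, H^{2k}(X) = ℚh^k by hard Lefschetz / Poincaré
duality, and h^k is algebraic (linear sections, `cupProduct_mem_algebraicClasses_of_moving`-type
facts). Needs real-framework Lefschetz facts for hypersurfaces — cite/vendor as named facts if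
absent. Sources: VoisinHodgeII2003 §1.2–2.3; Thomas2005Nodes Prop. 2. -/
@[route_item "route-HodgeConjecture-IncidenceNodePeeling", crux]
def HypersurfaceMiddleReduction : Prop :=
  (∀ (n : ℕ) (X : Literature.AlgebraicGeometry.Motives.SchemeOver ℂ), Literature.AlgebraicGeometry.HodgeTheory.nonempty_hodgeModel n X) → (∀ (p d : ℕ) (X : Literature.AlgebraicGeometry.Motives.SchemeOver ℂ) (ζ : Literature.AlgebraicGeometry.HodgeTheory.complexBetti X (2 * p)), Literature.AlgebraicGeometry.Motives.IsSmoothHypersurface (2 * p) d X → Literature.AlgebraicGeometry.HodgeTheory.IsRationalClass ζ → Literature.AlgebraicGeometry.HodgeTheory.IsOfHodgeType (2 * p) X (2 * p) p p ζ → ζ ∈ Literature.AlgebraicGeometry.HodgeTheory.algebraicClasses X p) → ∀ (n d : ℕ) (X : Literature.AlgebraicGeometry.Motives.SchemeOver ℂ), Literature.AlgebraicGeometry.Motives.IsSmoothHypersurface n d X → Literature.AlgebraicGeometry.HodgeTheory.HodgeConjectureFor n X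

/-- item stmt-HodgeConjecture-2351 · support · rank 9 · open · by planner
sources: Deligne2000
[support] COMPLEMENT REGIME, recorded only so that the assembly reaches `HodgeConjecture`; NOT
attacked by this route and NOT a claim of it (no reduction of HC to hypersurfaces is known; by
Zak–L'vovsky most X^{2p} are not ample divisors in any smooth (2p+1)-fold, so the incidence-divisor
engine does not even start). A later planner split may ENLARGE the route's own regime instead:
even-dimensional complete intersections, and smooth ample divisors X ⊂ P^{2p+1} with H^{2p}(P)|_X
algebraic (same engine with P in place of ℙ^{2p+1}), shrinking this complement accordingly. -/
@[route_item "route-HodgeConjecture-IncidenceNodePeeling", crux]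
def HCNonHypersurfaces : Prop :=
  ∀ (n : ℕ) (X : Literature.AlgebraicGeometry.Motives.SchemeOver ℂ), Literature.AlgebraicGeometry.Motives.IsSmoothProjective n X → (∀ d : ℕ, ¬ Literature.AlgebraicGeometry.Motives.IsSmoothHypersurface n d X) → Literature.AlgebraicGeometry.HodgeTheory.HodgeConjectureFor n X

/-- item stmt-HodgeConjecture-2352 · support · rank 9 · closed · proved by Summit.HodgeConjecture.HodgeConjecture.Theorems.incidenceNodePeeling_peelingBound_proof @ 196b5bceb1e8 (prover) · by planner
sources: VoisinHodgeI2002, Thomas2005Nodes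
[support] PEELING BOUND — pure linear algebra, provable in Mathlib now. B symmetric ℚ-bilinear on V,
δ_1..δ_k pairwise B-orthogonal with B(δ_i,δ_i) = 2, B(ζ,δ_i) ∈ ℤ∖{0}, and B(ζ',ζ') ≥ 0 for ζ' = ζ −
Σ_i (B(ζ,δ_i)/2)δ_i ⟹ k ≤ 2B(ζ,ζ). Proof: expand B(ζ',ζ') = B(ζ,ζ) − ½Σ_i B(ζ,δ_i)² and use
B(ζ,δ_i)² ≥ 1. DICTIONARY: B = (−1)^p × (intersection form) on H^{2p}(X,ℚ)_van transported along the
nodal chain; δ_i = vanishing cycles of the KEPT nodes (orthogonal because they are distinct points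
of one fibre; B(δ,δ) = 2 for even-dimensional ODPs); ζ integral; ζ' = ζ_k the residual class;
B(ζ_k,ζ_k) ≥ 0 is Hodge–Riemann for the primitive (p,p)-class ζ_k in the pure Hodge structure
H^{2p}(X_k) = ∩δ_i^⊥ of the ℚ-homology manifold X_k (IH Kähler package). CONSEQUENCE: the case-B
nodal chain of ForcingCaseB has length ≤ 2q(ζ_v) — termination is free (the card's worry about
denominators 2^j disappears once nodes are kept). -/
@[route_item "route-HodgeConjecture-IncidenceNodePeeling"]
def PeelingBound : Prop :=
  ∀ (V : Type) [AddCommGroup V] [Module ℚ V] (B : LinearMap.BilinForm ℚ V) (k : ℕ) (δ : Fin k → V) (ζ : V), B.IsSymm → (∀ i j : Fin k, i ≠ j → B (δ i) (δ j) = 0) → (∀ i : Fin k, B (δ i) (δ i) = 2) → (∀ i : Fin k, B ζ (δ i) ≠ 0 ∧ ∃ m : ℤ, B ζ (δ i) = m) → 0 ≤ B (ζ - ∑ i : Fin k, (B ζ (δ i) / 2) • δ i) (ζ - ∑ i : Fin k, (B ζ (δ i) / 2) • δ i) → (k : ℚ) ≤ 2 * B ζ ζ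

-- item stmt-HodgeConjecture-2504 · support · rank 9 · open · by planner — informal only, no Lean statement yet:
--   [support] INCIDENCE FORCING THEOREM — the engine of ForcingCaseB as a stand-alone, paper-provable
--   deliverable (Lean is far: needs intersection cohomology / perverse sheaves / Milnor fibrations on
--   complex points; definition requests filed; provers may attach a written proof as evidence). For X ⊂
--   P a smooth very ample divisor in a smooth projective (2p+1)-fold P (P = ℙ^{2p+1} for this route), ζ
--   ∈ Hdg^{2p}(X,ℚ) with ζ ∉ Im(H^{2p}(P) → H^{2p}(X)), Z̄' the normalised closure of a Hodge-locus
--   component of ζ in |O_P(X)| that is positive-dimensional modulo Aut(P), S ⊂ Z̄' a general normal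
--   projective s

/-- item stmt-HodgeConjecture-2353 · assembly · rank 1 · closed · proved by Summit.HodgeConjecture.HodgeConjecture.Theorems.incidenceNodePeeling_assembly_proof @ 6fbee03b00bb (prover) · by planner
sources: Deligne2000, Thomas2005Nodes
[assembly] HCMovablePairs → HCRigidPairs → HypersurfaceMiddleReduction → HCNonHypersurfaces → (∀ n
X, nonempty_hodgeModel n X) → HodgeConjecture. PURE LOGIC (case split MOVABLE/¬MOVABLE and
hypersurface/not; `_root_.HodgeConjecture` unfolds to ∀ n X, IsSmoothProjective n X →
HodgeConjectureFor n X); checked provable in the planner's Sketch.lean (example, not published — a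
prover closes it in Theorems/). The mathematics of the line sits in the informal cruxes ForcingCaseB
(rank 2) ≻ EndStateSupported (3) ≻ ReturnAlongHodgeLocus (4), whose conjunction (glue =
NodalExhaustion, with PeelingBound) is the intended proof of HCMovablePairs; HCRigidPairs is
imported. NB the sub-problem constant is the root-level `HodgeConjecture` of
Summits/HodgeConjecture/HodgeConjecture/Statement.lean (no `Summit.` namespace in that file). -/
@[route_item "route-HodgeConjecture-IncidenceNodePeeling"]
def Assembly : Prop :=
  HCMovablePairs → HCRigidPairs → HypersurfaceMiddleReduction → HCNonHypersurfaces → (∀ (n : ℕ) (X : Literature.AlgebraicGeometry.Motives.SchemeOver ℂ), Literature.AlgebraicGeometry.HodgeTheory.nonempty_hodgeModel n X) → _root_.HodgeConjecture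

/-! D-0027 §2.1 — DECIDING THEOREM (planner-authored via `route open/edit --closes-file`; by planner-rbadge-HodgeConjecture-IncidenceNodePe-2fffaacc-g2-0 2026-08-15T16:15:23Z):
its hypotheses are this route's items and its conclusion the sub-problem Statement (glue_lint), and it elaborates with this file. -/

@[closes "route-HodgeConjecture-IncidenceNodePeeling"] theorem closes (h₁ : HCMovablePairs) (h₂ : HCRigidPairs) (h₃ : HodgeModels)
    (h₄ : HypersurfaceMiddleReduction) (h₅ : HCNonHypersurfaces) : _root_.HodgeConjecture := by
  intro n X hX
  by_cases hhyp : ∃ d : ℕ, Literature.AlgebraicGeometry.Motives.IsSmoothHypersurface n d X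
  · obtain ⟨d, hd⟩ := hhyp
    exact h₄ h₃ (fun p d' Y ζ hY hq hpp =>
      (Classical.em _).elim (h₁ p d' Y ζ hY hq hpp) (h₂ p d' Y ζ hY hq hpp)) n d X hd
  · exact h₅ n X hX (fun d hd => hhyp ⟨d, hd⟩)

end Summit.HodgeConjecture.HodgeConjecture.Theses.IncidenceNodePeeling
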